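import Summits.Ventures.PercRepro.RankLevelSet
import Summits.Ventures.PercRepro.MatroidMidCount

/-!
# PercRepro — Lemma J₂ in the vocabulary of `C025` (typer-2, gen 6)

The bridge from `MatroidMidCount.lean` (counts `topCount` / `midCount`, constant `phiTwo`) to the row `C025`
(`phiK p q`, the two `Set.ncard` bodies): **`phiK_two_eq_phiTwo`** (`rfl`) and **`rls_two_of_isColoop`** — mine-2's
LEMMA J₂ (§14 Step 1) stated EXACTLY as the hypothesis `hcolo` of p2's induction wrapper `rls_two_all`
(`TheoremNAll.lean`): for `p ≥ 4`, a coloop `e` and `r(M) = p`, the sum form at `(p − 1, 2)` for `M ＼ {e}` (only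
needed when `p ≥ 5`) gives the sum form at `(p, 2)` for `M`.
-/

namespace PercRepro

open Set

/-- `Φ(p, 2)` of `OrbitK` is the `phiTwo p` of the binomial layer (the same expression). -/
theorem phiK_two_eq_phiTwo (p : ℕ) : phiK p 2 = BinomialLayer.phiTwo p := rfl

namespace Matroid

variable {α : Type*}

/-- **Lemma J₂ in the shape of `hcolo`** (p2's `rls_two_all`): `4 ≤ p`, `e` a coloop of `M`, `r(M) = p`; if
`5 ≤ p` implies `Φ(p − 1, 2) · #U_{M ＼ {e}}(p − 1, 2) ≤ #Y_{M ＼ {e}}(p − 1, 2)` then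
`Φ(p, 2) · #U_M(p, 2) ≤ #Y_M(p, 2)` (bodies as in `C025`). `p = 4` is `sumForm_of_isColoop_four`, `p ≥ 5` is
`sumForm_of_isColoop`. -/
theorem rls_two_of_isColoop (M : _root_.Matroid α) [M.Finite] (e : α) (p : ℕ) (hp : 4 ≤ p)
    (he : M.IsColoop e) (hR : M.eRank = (p : ℕ∞))
    (hIH : 5 ≤ p → phiK (p - 1) 2 *
      ({A : Set α | A ⊆ (M.delete {e}).E ∧ (M.delete {e}).eRk A = ((p - 1 : ℕ) : ℕ∞) ∧
        (M.delete {e}).eRk ((M.delete {e}).E \ A) = ((2 : ℕ) : ℕ∞)}.ncard : ℚ) ≤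
      ({A : Set α | A ⊆ (M.delete {e}).E ∧ ((2 : ℕ) : ℕ∞) < (M.delete {e}).eRk A ∧
        (M.delete {e}).eRk A < ((p - 1 : ℕ) : ℕ∞)}.ncard : ℚ)) :
    phiK p 2 * ({A : Set α | A ⊆ M.E ∧ M.eRk A = (p : ℕ∞) ∧ M.eRk (M.E \ A) = ((2 : ℕ) : ℕ∞)}.ncard : ℚ) ≤
      ({A : Set α | A ⊆ M.E ∧ ((2 : ℕ) : ℕ∞) < M.eRk A ∧ M.eRk A < (p : ℕ∞)}.ncard : ℚ) := by
  obtain ⟨p', rfl⟩ : ∃ p', p = p' + 1 := ⟨p - 1, by omega⟩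
  change BinomialLayer.phiTwo (p' + 1) * (topCount M (p' + 1) 2 : ℚ) ≤ (midCount M (p' + 1) 2 : ℚ)
  rcases Nat.lt_or_ge p' 4 with h | h
  · have h3 : p' = 3 := by omega
    subst h3
    exact sumForm_of_isColoop_four he hR
  · have hIH' := hIH (by omega)
    rw [Nat.add_sub_cancel] at hIH'
    have hIH'' : BinomialLayer.phiTwo p' * (topCount (M.delete {e}) p' 2 : ℚ) ≤
        (midCount (M.delete {e}) p' 2 : ℚ) := hIH'
    exact sumForm_of_isColoop he h hR hIH''

end Matroid

end PercRepro
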